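import Summits.NavierStokesRegularity.NavierStokesRegularity.Theorems.ExtremiserTransienceTwoThirdsDefs
import HarnessLib

/-!
# Route `ExtremiserTransience`, crux `NearExtremalTransiencePerFlow` (stmt-NavierStokesRegularity-26567),
# LINE g10-1 «two_thirds» (ideator ns-idea-10 g10), stub S1a `TypicalSelection` — BRICK 3a: ABSTRACT TYPICALITY, Theorems-side port

`--supports stmt-NavierStokesRegularity-26567` (helper; prover seat ns-net-p2 g12).  VERBATIM PORT of §3b of the line file
`Cruxes/NearExtremalTransience/Lines/two_thirds.lean` REV 1.2 (9b1e29b3e15f), PROVED there by the line's author **ns-idea-10 g10**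
(credit: statements and proofs are the author's; this file only re-homes them under `Theorems/` so that the Theorems-side proof of
S1a can import them — `Theorems/` files cannot import `Cruxes/`).

The finite Chebyshev–Cauchy–Schwarz core of S1a: for ONE packing (pieces `i ∈ s` = the thick balls of a translated packing plus the
remainder piece, after the cut-off junk has been absorbed into `ε`): per-piece sharp inequality + sub-additive budgets + GLOBAL
near-equality force the enstrophy carried by pieces that are NOT good (local extremality below `1 − η`, or squared-Taylor ratio off by
more than `δ`) to be `≤ ε·(18/δ² + 2/η)·Z`.
* `sq_defect_of_ratio_bad` — `δx² < |y² − x²| ⇒ (x − y)² ≥ δ²x²/9`;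
* `pointwise_bad_le` — a bad piece's enstrophy is paid by its Cauchy–Schwarz defect or by its sharp-inequality slack;
* `typicality_abstract` — the bad pieces carry `≤ ε(18/δ² + 2/η)·Z`.
HONEST FRAMING: finite real algebra; nothing about Navier–Stokes is proved; no summit is proved by a line. [folklore]
-/

noncomputable section

open scoped Topology InnerProductSpace RealInnerProductSpace ENNReal
open MeasureTheory Filter Set

namespace Summit.NavierStokesRegularity.NavierStokesRegularity.Theorems.NearExtremalTransiencePerFlow.TwoThirds

-- the problem directory repeats the summit name (`NavierStokesRegularity/NavierStokesRegularity`)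
set_option linter.dupNamespace false
set_option linter.style.longLine false

/-- (ns-idea-10 g10, `Lines/two_thirds.lean` §3b, verbatim port.) Square-root defect controls the ratio: if `δ·x² < |y² − x²|` then `(x − y)² ≥ δ²x²/9`
(`x = √Z_P`, `y = √(λ² W_P)`). -/
theorem sq_defect_of_ratio_bad {x y δ : ℝ} (hx : 0 ≤ x) (hy : 0 ≤ y) (hδ : 0 < δ) (hδ1 : δ ≤ 1/2)
    (hbad : δ * x ^ 2 < |y ^ 2 - x ^ 2|) : δ ^ 2 * x ^ 2 / 9 ≤ (x - y) ^ 2 := by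
  by_contra h
  push Not at h
  set d := |y - x| with hd
  have hd0 : 0 ≤ d := abs_nonneg _
  have hdsq : d ^ 2 < (δ * x / 3) ^ 2 := by
    have : d ^ 2 = (x - y) ^ 2 := by rw [hd, sq_abs]; ring
    rw [this]; nlinarith
  have hd1 : d < δ * x / 3 := by
    exact lt_of_pow_lt_pow_left₀ 2 (by positivity) hdsq
  have hd2 : d ≤ x / 6 := by nlinarith
  have hfac : |y ^ 2 - x ^ 2| = d * (y + x) := by
    have : y ^ 2 - x ^ 2 = (y - x) * (y + x) := by ring
    rw [this, abs_mul, abs_of_nonneg (by linarith : 0 ≤ y + x)]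
  have hyle : y ≤ x + d := by
    have : y - x ≤ |y - x| := le_abs_self _
    linarith
  rw [hfac] at hbad
  have h1 : d * (y + x) ≤ d * (2 * x + d) := by
    apply mul_le_mul_of_nonneg_left _ hd0; linarith
  have h2 : d * (2 * x + d) ≤ (δ * x / 3) * (2 * x + d) :=
    mul_le_mul_of_nonneg_right hd1.le (by linarith)
  have h3 : (δ * x / 3) * (2 * x + d) ≤ (δ * x / 3) * (2 * x + x / 6) := by
    apply mul_le_mul_of_nonneg_left _ (by positivity); linarith
  nlinarith [sq_nonneg x]

/-- (ns-idea-10 g10, `Lines/two_thirds.lean` §3b, verbatim port.) Pointwise accounting: the enstrophy of a BAD piece (deficient local extremality OR ratio off) is paid for by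
the piece's Cauchy–Schwarz defect `(√Z_P − √(L W_P))²` or by its sharp-inequality slack `κ√(Z_P W_P) − J_P`. -/
theorem pointwise_bad_le {κ L η δ J Z W : ℝ} (hκ : 0 < κ) (hL : 0 < L) (hη : 0 < η) (hδ : 0 < δ)
    (hδ1 : δ ≤ 1/2) (hZ : 0 ≤ Z) (hW : 0 ≤ W) (hsharp : J ≤ κ * √(Z * W)) :
    (if (J < κ * √(Z * W) * (1 - η) ∨ δ * Z < |L * W - Z|) then Z else 0)
      ≤ (9 / δ ^ 2) * (√Z - √(L * W)) ^ 2 + (√(2 * L) / (κ * η)) * (κ * √(Z * W) - J) := by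
  have hslack : 0 ≤ κ * √(Z * W) - J := by linarith
  have hA : 0 ≤ (9 / δ ^ 2) * (√Z - √(L * W)) ^ 2 := by positivity
  have hB : 0 ≤ (√(2 * L) / (κ * η)) * (κ * √(Z * W) - J) := by positivity
  split_ifs with hbad
  · rcases hbad with hext | hrat
    · -- either ratio-bad (first term pays) or ratio-good (second term pays)
      by_cases hrat : δ * Z < |L * W - Z|
      · -- ratio-bad
        have key := sq_defect_of_ratio_bad (Real.sqrt_nonneg Z) (Real.sqrt_nonneg (L * W)) hδ hδ1
          (by rw [Real.sq_sqrt hZ, Real.sq_sqrt (by positivity : (0:ℝ) ≤ L * W)]; exact hrat)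
        rw [Real.sq_sqrt hZ] at key
        have : Z ≤ (9 / δ ^ 2) * (√Z - √(L * W)) ^ 2 := by
          rw [div_mul_eq_mul_div, le_div_iff₀ (by positivity)]
          nlinarith
        linarith
      · -- ratio-good and extremality-bad
        push Not at hrat
        have hLW : Z ≤ 2 * (L * W) := by
          have := (abs_le.1 hrat).1
          nlinarith
        have hZle : Z ≤ √(2 * L) * √(Z * W) := by
          rw [← Real.sqrt_mul (by positivity)]
          have h2 : Z ^ 2 ≤ 2 * L * (Z * W) := by nlinarith
          calc Z = √(Z ^ 2) := (Real.sqrt_sq hZ).symm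
            _ ≤ √(2 * L * (Z * W)) := Real.sqrt_le_sqrt h2
        have hs : η * (κ * √(Z * W)) ≤ κ * √(Z * W) - J := by nlinarith
        have : Z ≤ (√(2 * L) / (κ * η)) * (κ * √(Z * W) - J) := by
          rw [div_mul_eq_mul_div, le_div_iff₀ (by positivity)]
          calc Z * (κ * η) = (κ * η) * Z := by ring
            _ ≤ (κ * η) * (√(2 * L) * √(Z * W)) := by
                apply mul_le_mul_of_nonneg_left hZle; positivity
            _ = √(2 * L) * (η * (κ * √(Z * W))) := by ring
            _ ≤ √(2 * L) * (κ * √(Z * W) - J) := by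
                apply mul_le_mul_of_nonneg_left hs; positivity
        linarith
    · -- ratio-bad
      have key := sq_defect_of_ratio_bad (Real.sqrt_nonneg Z) (Real.sqrt_nonneg (L * W)) hδ hδ1
        (by rw [Real.sq_sqrt hZ, Real.sq_sqrt (by positivity : (0:ℝ) ≤ L * W)]; exact hrat)
      rw [Real.sq_sqrt hZ] at key
      have : Z ≤ (9 / δ ^ 2) * (√Z - √(L * W)) ^ 2 := by
        rw [div_mul_eq_mul_div, le_div_iff₀ (by positivity)]
        nlinarith
      linarith
  · positivity

open Finset in
/-- (ns-idea-10 g10, `Lines/two_thirds.lean` §3b, verbatim port.) ABSTRACT TYPICALITY (Chebyshev + Cauchy–Schwarz; the finite core of S1a).  Pieces `i ∈ s` with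
non-negative local enstrophies `Zp i`, palinstrophies `Wp i`, stretchings `Jp i ≤ κ√(Zp i · Wp i)` (sharp
inequality per piece), sub-additive budgets `Σ Zp ≤ Z`, `Σ Wp ≤ W` and GLOBAL near-equality
`κ√(ZW)(1−ε) ≤ Σ Jp`; `L = Z/W` the global squared Taylor ratio.  Then the pieces that are NOT good —
local extremality below `1 − η` OR ratio `|L·Wp − Zp| > δ·Zp` — carry at most `ε(18/δ² + 2/η)·Z` of enstrophy. -/
theorem typicality_abstract {ι : Type*} (s : Finset ι) {κ Z W L ε η δ : ℝ} (Jp Zp Wp : ι → ℝ)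
    (hκ : 0 < κ) (hZ : 0 < Z) (hW : 0 < W) (hLW : L * W = Z) (hη : 0 < η) (hδ : 0 < δ)
    (hδ1 : δ ≤ 1/2) (hZp : ∀ i ∈ s, 0 ≤ Zp i) (hWp : ∀ i ∈ s, 0 ≤ Wp i)
    (hsharp : ∀ i ∈ s, Jp i ≤ κ * √(Zp i * Wp i))
    (hsubZ : ∑ i ∈ s, Zp i ≤ Z) (hsubW : ∑ i ∈ s, Wp i ≤ W)
    (hnear : κ * √(Z * W) * (1 - ε) ≤ ∑ i ∈ s, Jp i) :
    ∑ i ∈ s.filter (fun i => Jp i < κ * √(Zp i * Wp i) * (1 - η) ∨ δ * Zp i < |L * Wp i - Zp i|), Zp i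
      ≤ ε * (18 / δ ^ 2 + 2 / η) * Z := by
  have hL : 0 < L := by
    by_contra h; push Not at h; nlinarith
  -- Cauchy–Schwarz: S := Σ √Zp √Wp ≤ √Z √W
  set S := ∑ i ∈ s, √(Zp i * Wp i) with hS
  have hS0 : 0 ≤ S := sum_nonneg fun i _ => Real.sqrt_nonneg _
  have hSeq : S = ∑ i ∈ s, √(Zp i) * √(Wp i) := by
    rw [hS]; exact sum_congr rfl fun i hi => Real.sqrt_mul (hZp i hi) _
  have hCS : S ^ 2 ≤ Z * W := by
    rw [hSeq]
    calc (∑ i ∈ s, √(Zp i) * √(Wp i)) ^ 2 ≤ (∑ i ∈ s, √(Zp i) ^ 2) * (∑ i ∈ s, √(Wp i) ^ 2) :=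
          sum_mul_sq_le_sq_mul_sq s _ _
      _ = (∑ i ∈ s, Zp i) * (∑ i ∈ s, Wp i) := by
          congr 1
          · exact sum_congr rfl fun i hi => Real.sq_sqrt (hZp i hi)
          · exact sum_congr rfl fun i hi => Real.sq_sqrt (hWp i hi)
      _ ≤ Z * W := mul_le_mul hsubZ hsubW (sum_nonneg hWp) hZ.le
  have hSle : S ≤ √(Z * W) := by
    calc S = √(S ^ 2) := (Real.sqrt_sq hS0).symm
      _ ≤ √(Z * W) := Real.sqrt_le_sqrt hCS
  -- lower bound on S from near-equality and the sharp inequality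
  have hJle : ∑ i ∈ s, Jp i ≤ κ * S := by
    rw [hS, mul_sum]; exact sum_le_sum hsharp
  have hSge : κ * √(Z * W) * (1 - ε) ≤ κ * S := le_trans hnear hJle
  have hκS : κ * S ≤ κ * √(Z * W) := mul_le_mul_of_nonneg_left hSle hκ.le
  have hZWpos : 0 < κ * √(Z * W) := by positivity
  have hε0 : 0 ≤ ε := by
    by_contra hneg; push Not at hneg
    nlinarith [mul_pos hZWpos (neg_pos.2 hneg)]
  have hS1 : √(Z * W) * (1 - ε) ≤ S := by
    have h' : κ * (√(Z * W) * (1 - ε)) ≤ κ * S := by rw [← mul_assoc]; exact hSge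
    exact le_of_mul_le_mul_left h' hκ
  -- the key identity √L · √(ZW) = Z
  have hLZW : √L * √(Z * W) = Z := by
    rw [← Real.sqrt_mul hL.le, show L * (Z * W) = Z * Z by rw [← hLW]; ring]
    exact Real.sqrt_mul_self hZ.le
  -- ε ≥ 0 is forced unless the sum is empty-ish; we derive what we need: εκ√(ZW) ≥ κ√(ZW) − κS ≥ 0
  have hεZW : κ * √(Z * W) - κ * S ≤ ε * (κ * √(Z * W)) := by nlinarith
  have hslack_sum : ∑ i ∈ s, (κ * √(Zp i * Wp i) - Jp i) ≤ ε * (κ * √(Z * W)) := by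
    rw [sum_sub_distrib, ← mul_sum, ← hS]; linarith [hκS, hnear]
  -- the CS-defect sum
  have hdef_sum : ∑ i ∈ s, (√(Zp i) - √(L * Wp i)) ^ 2 ≤ 2 * ε * Z := by
    have hexp : ∀ i ∈ s, (√(Zp i) - √(L * Wp i)) ^ 2 = Zp i + L * Wp i - 2 * (√L * √(Zp i * Wp i)) := by
      intro i hi
      have h1 : √(L * Wp i) = √L * √(Wp i) := Real.sqrt_mul hL.le _
      have h2 : √(Zp i * Wp i) = √(Zp i) * √(Wp i) := Real.sqrt_mul (hZp i hi) _
      rw [h1, h2, sub_sq, Real.sq_sqrt (hZp i hi), mul_pow, Real.sq_sqrt hL.le, Real.sq_sqrt (hWp i hi)]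
      ring
    rw [sum_congr rfl hexp, sum_sub_distrib, sum_add_distrib, ← mul_sum, ← mul_sum, ← mul_sum, ← hS]
    have hSZ : (1 - ε) * Z ≤ √L * S := by
      have h1 := mul_le_mul_of_nonneg_left hS1 (Real.sqrt_nonneg L)
      have e : √L * (√(Z * W) * (1 - ε)) = Z * (1 - ε) := by rw [← mul_assoc, hLZW]
      linarith
    have hLWs : L * ∑ i ∈ s, Wp i ≤ Z := by
      calc L * ∑ i ∈ s, Wp i ≤ L * W := mul_le_mul_of_nonneg_left hsubW hL.le
        _ = Z := hLW
    linarith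
  -- pointwise accounting summed
  have hpt : ∀ i ∈ s, (if (Jp i < κ * √(Zp i * Wp i) * (1 - η) ∨ δ * Zp i < |L * Wp i - Zp i|) then Zp i else 0)
      ≤ (9 / δ ^ 2) * (√(Zp i) - √(L * Wp i)) ^ 2 + (√(2 * L) / (κ * η)) * (κ * √(Zp i * Wp i) - Jp i) :=
    fun i hi => pointwise_bad_le hκ hL hη hδ hδ1 (hZp i hi) (hWp i hi) (hsharp i hi)
  have h2LZ : √(2 * L) * √(Z * W) ≤ 2 * Z := by
    rw [← Real.sqrt_mul (by positivity : (0:ℝ) ≤ 2 * L)]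
    have e : 2 * L * (Z * W) = 2 * Z ^ 2 := by
      calc 2 * L * (Z * W) = 2 * Z * (L * W) := by ring
        _ = 2 * Z ^ 2 := by rw [hLW]; ring
    calc √(2 * L * (Z * W)) = √(2 * Z ^ 2) := by rw [e]
      _ ≤ √((2 * Z) ^ 2) := Real.sqrt_le_sqrt (by nlinarith)
      _ = 2 * Z := Real.sqrt_sq (by positivity)
  have T1 : (9 / δ ^ 2) * ∑ i ∈ s, (√(Zp i) - √(L * Wp i)) ^ 2 ≤ ε * (18 / δ ^ 2) * Z := by
    calc (9 / δ ^ 2) * ∑ i ∈ s, (√(Zp i) - √(L * Wp i)) ^ 2 ≤ (9 / δ ^ 2) * (2 * ε * Z) :=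
          mul_le_mul_of_nonneg_left hdef_sum (by positivity)
      _ = ε * (18 / δ ^ 2) * Z := by ring
  have T2 : (√(2 * L) / (κ * η)) * ∑ i ∈ s, (κ * √(Zp i * Wp i) - Jp i) ≤ ε * (2 / η) * Z := by
    calc (√(2 * L) / (κ * η)) * ∑ i ∈ s, (κ * √(Zp i * Wp i) - Jp i)
        ≤ (√(2 * L) / (κ * η)) * (ε * (κ * √(Z * W))) :=
          mul_le_mul_of_nonneg_left hslack_sum (by positivity)
      _ = (ε / η) * (√(2 * L) * √(Z * W)) * (κ / κ) := by ring
      _ = (ε / η) * (√(2 * L) * √(Z * W)) := by rw [div_self hκ.ne', mul_one]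
      _ ≤ (ε / η) * (2 * Z) := mul_le_mul_of_nonneg_left h2LZ (by positivity)
      _ = ε * (2 / η) * Z := by ring
  rw [Finset.sum_filter]
  refine le_trans (Finset.sum_le_sum hpt) ?_
  rw [Finset.sum_add_distrib, ← Finset.mul_sum, ← Finset.mul_sum]
  calc (9 / δ ^ 2) * ∑ i ∈ s, (√(Zp i) - √(L * Wp i)) ^ 2
        + (√(2 * L) / (κ * η)) * ∑ i ∈ s, (κ * √(Zp i * Wp i) - Jp i)
      ≤ ε * (18 / δ ^ 2) * Z + ε * (2 / η) * Z := add_le_add T1 T2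
    _ = ε * (18 / δ ^ 2 + 2 / η) * Z := by ring


end Summit.NavierStokesRegularity.NavierStokesRegularity.Theorems.NearExtremalTransiencePerFlow.TwoThirds

end
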